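import Summits.BirchSwinnertonDyer.BirchSwinnertonDyer.Theses.UniversalToricDescent
import Summits.BirchSwinnertonDyer.BirchSwinnertonDyer.Theorems.UniversalToricDescentToricTransportModThreeNormProfile
import HarnessLib

/-!
# Route UniversalToricDescent — glue item `ToricTransportModThreeOfWallPieces` of the «β over the wall» split of crux #2 `ToricTransportModThree`

The three children (AdditiveSplitIMCInclusionAtThree = one inclusion at the additive point; InvariantsTransportModThree =
Greenberg–Vatsal transport of (μ, λ); TwinMuZeroAtThree = μ = 0 for the twin) give the crux by Greenberg–Vatsal's
argument, closed by `UniversalToricDescentNormProfile.eq_span_of_span_le_of_normProfile` (p531417): one inclusion +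
equal norm profile ⇒ equality of principal ideals of `R₀⟦T⟧`. Kernel-checked before the split as
`Cruxes/…/Split.toricTransportModThree_of_split` (evidence on stmt-BirchSwinnertonDyer-20186, sha16 2ecda915662147cb).
-/

set_option linter.dupNamespace false

namespace Summit.BirchSwinnertonDyer.BirchSwinnertonDyer.Theorems

/-- **Glue of the 20186 split holds**: S_div → S_inv → S_μ′ → `ToricTransportModThree` (Greenberg–Vatsal composition;
closing algebra `eq_span_of_span_le_of_normProfile`). [cite: GreenbergVatsal2000, Thm. 1.4 (shape of the transport)] -/
theorem toricTransportModThreeOfWallPieces_proof :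
    Summit.BirchSwinnertonDyer.BirchSwinnertonDyer.Theses.UniversalToricDescent.ToricTransportModThreeOfWallPieces := by
  intro hdiv hinv hμ W _ _ W' _ _ N N' _ _ K _ _ Dt Dt' hO6 honto hr hN hcong haddv hN' hK hH hH' κ hκ γ _ 𝔭 h𝔭
    he hf 𝔭' h𝔭' hne ι' hι' hex heq' ΩK Ωp L hΩK hΩp hL
  have hμ' := hμ W W' N N' K Dt Dt' hO6 honto hr hN hcong haddv hN' hK hH hH' κ hκ γ 𝔭 h𝔭 he hf 𝔭' h𝔭' hne ι' hι'
  obtain ⟨g, n, hI, hg, -, -, hLn⟩ := hinv W W' N N' K Dt Dt' hO6 honto hr hN hcong haddv hN' hK hH hH'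
    κ hκ γ 𝔭 h𝔭 he hf 𝔭' h𝔭' hne ι' hι' hex heq' hμ' ΩK Ωp L hΩK hΩp hL
  have hle := hdiv W N K Dt hO6 honto hr hN hK hH κ hκ γ 𝔭 h𝔭 he hf 𝔭' h𝔭' hne ι' hι' ΩK Ωp L hΩK hΩp hL
  exact Summit.BirchSwinnertonDyer.BirchSwinnertonDyer.Theorems.UniversalToricDescentNormProfile.eq_span_of_span_le_of_normProfile
    hI hle hg hLn

end Summit.BirchSwinnertonDyer.BirchSwinnertonDyer.Theorems
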